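import Mathlib.Analysis.Complex.UpperHalfPlane.FixedPoints
import Mathlib.NumberTheory.ModularForms.CongruenceSubgroups
import HarnessLib

/-!
# `Γ(2)` acts on `ℍ` without fixed points (up to `±1`): `Y(2)` has no elliptic points

Companion of `Literature/NumberTheory/Automorphic/GammaTwoGenerators.lean`. The principal
congruence subgroup `Γ(2) ≤ SL(2, ℤ)` contains no elliptic elements: if `γ ∈ Γ(2)` fixes a point
of the upper half-plane then `γ = ±1`. Equivalently `Γ(2)/{±1}` acts freely on `ℍ`, the
quotient `Y(2) = ℍ/Γ(2)` has no elliptic points, and the uniformization `λ : ℍ → Y(2) ≅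
ℙ¹ ∖ {0, 1, ∞}` is unramified — the fact behind "an affine modular curve `Y` over `ℚ̄` which
admits a finite étale map to `Y(2)`" in Calegari–Dimitrov–Tang (F. Calegari, V. Dimitrov,
Y. Tang, *The unbounded denominators conjecture*, J. Amer. Math. Soc. **38** (2025),
arXiv:2109.09040, §3, proof of Proposition 15; Diamond–Shurman, *A First Course in Modular Forms*,
Exercise 2.3.7 / §3.9: `Γ(N)` is torsion-free modulo `±1` for `N ≥ 2`... here `N = 2`, where
`−1 ∈ Γ(2)`).

* `GammaTwo.trace_mod_four` — for `γ ∈ Γ(2)`, `tr γ ≡ 2 (mod 4)` (`a ≡ d ≡ 1`, `b ≡ c ≡ 0 (mod 2)`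
  and `ad − bc = 1` force `a ≡ d (mod 4)`);
* **`GammaTwo.eq_one_or_eq_neg_one_of_smul_eq`** — `γ ∈ Γ(2)`, `γ • z = z` for some `z ∈ ℍ`
  `⟹ γ = 1 ∨ γ = −1` (a non-scalar element of `SL(2, ℝ)` with a fixed point in `ℍ` is elliptic,
  `|tr| < 2` — Mathlib `UpperHalfPlane.isElliptic_of_exists_smul_eq_self` — impossible for
  `tr ≡ 2 (mod 4)`);
* `GammaTwo.smul_eq_self_iff` — `γ • z = z ↔ γ = 1 ∨ γ = −1` for `γ ∈ Γ(2)`.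

## References

* F. Diamond, J. Shurman, *A First Course in Modular Forms*, GTM 228, §2.3 (elliptic points;
  Exercise 2.3.7), §3.9.
* [CalegariDimitrovTang2025] arXiv:2109.09040, §3, proof of Proposition 15 (`Y → Y(2)` étale).
-/

namespace Literature.NumberTheory.Automorphic

namespace GammaTwo

open Matrix Matrix.SpecialLinearGroup CongruenceSubgroup UpperHalfPlane

open scoped MatrixGroups

/-- **`tr γ ≡ 2 (mod 4)` for `γ ∈ Γ(2)`.** With `a ≡ d ≡ 1`, `b ≡ c ≡ 0 (mod 2)` the
determinant condition `ad − bc = 1` reads `ad ≡ 1 (mod 4)`, forcing `a ≡ d (mod 4)` and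
`a + d ≡ 2a ≡ 2 (mod 4)`. [folklore] -/
theorem trace_mod_four {γ : SL(2, ℤ)} (hγ : γ ∈ Gamma 2) : (4 : ℤ) ∣ γ 0 0 + γ 1 1 - 2 := by
  obtain ⟨h00, h01, h10, h11⟩ := Gamma_mem.mp hγ
  -- parities as divisibilities
  have ha : (2 : ℤ) ∣ γ 0 0 - 1 := by
    have h : ((γ 0 0 : ℤ) : ZMod 2) = ((1 : ℤ) : ZMod 2) := by rw [h00, Int.cast_one]
    have := (ZMod.intCast_eq_intCast_iff_dvd_sub (γ 0 0) 1 2).mp h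
    simpa [dvd_sub_comm] using this
  have hd : (2 : ℤ) ∣ γ 1 1 - 1 := by
    have h : ((γ 1 1 : ℤ) : ZMod 2) = ((1 : ℤ) : ZMod 2) := by rw [h11, Int.cast_one]
    have := (ZMod.intCast_eq_intCast_iff_dvd_sub (γ 1 1) 1 2).mp h
    simpa [dvd_sub_comm] using this
  have hb : (2 : ℤ) ∣ γ 0 1 := by exact_mod_cast (ZMod.intCast_zmod_eq_zero_iff_dvd _ 2).mp h01
  have hc : (2 : ℤ) ∣ γ 1 0 := by exact_mod_cast (ZMod.intCast_zmod_eq_zero_iff_dvd _ 2).mp h10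
  obtain ⟨a', ha'⟩ := ha
  obtain ⟨d', hd'⟩ := hd
  obtain ⟨b', hb'⟩ := hb
  obtain ⟨c', hc'⟩ := hc
  have hdet : γ 0 0 * γ 1 1 - γ 0 1 * γ 1 0 = 1 := by
    have h := γ.prop
    rwa [Matrix.det_fin_two] at h
  have hA : γ 0 0 = 2 * a' + 1 := by linear_combination ha'
  have hD : γ 1 1 = 2 * d' + 1 := by linear_combination hd'
  have hdet' : (2 * a' + 1) * (2 * d' + 1) - (2 * b') * (2 * c') = 1 := by
    rw [← hA, ← hD, ← hb', ← hc']
    exact hdet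
  refine ⟨b' * c' - a' * d', ?_⟩
  rw [hA, hD]
  linear_combination hdet'

/-- **An element of `Γ(2)` with a fixed point in `ℍ` is `±1`** (`Γ(2)/{±1}` acts freely on
`ℍ`; `Y(2)` has no elliptic points). A non-central element of `GL(2, ℝ)⁺` fixing a point of `ℍ` is
elliptic (Mathlib `isElliptic_of_exists_smul_eq_self`), i.e. `tr² < 4 det = 4`, so `|tr γ| ≤ 1`,
contradicting `tr γ ≡ 2 (mod 4)`; a central element of `SL(2, ℤ)` is `±1`. [folklore] -/
theorem eq_one_or_eq_neg_one_of_smul_eq {γ : SL(2, ℤ)} (hγ : γ ∈ Gamma 2) {z : ℍ}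
    (h : γ • z = z) : γ = 1 ∨ γ = -1 := by
  set g : GL (Fin 2) ℝ := mapGL ℝ γ with hg
  have hgz : g • z = z := h
  have hval : ∀ i j, g.val i j = ((γ i j : ℤ) : ℝ) := fun i j ↦ rfl
  have hdetZ : γ 0 0 * γ 1 1 - γ 0 1 * γ 1 0 = 1 := by
    have h := γ.prop
    rwa [Matrix.det_fin_two] at h
  have hdet1 : g.val.det = 1 := by
    rw [Matrix.det_fin_two, hval, hval, hval, hval]
    exact_mod_cast hdetZ
  have hdet : 0 < g.val.det := by
    rw [hdet1]
    exact one_pos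
  by_cases hc : g ∈ Subgroup.center (GL (Fin 2) ℝ)
  · -- scalar: `γ = a • 1` with `a = ±1`
    obtain ⟨r, hr⟩ := Matrix.GeneralLinearGroup.mem_center_iff_val_mem_range_scalar.mp hc
    have e : ∀ i j, ((γ i j : ℤ) : ℝ) = (Matrix.scalar (Fin 2) r) i j := fun i j ↦ by
      rw [← hval, ← hr]
    have e01 : ((γ 0 1 : ℤ) : ℝ) = 0 := by rw [e 0 1]; simp
    have e10 : ((γ 1 0 : ℤ) : ℝ) = 0 := by rw [e 1 0]; simp
    have e00 : ((γ 0 0 : ℤ) : ℝ) = r := by rw [e 0 0]; simp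
    have e11 : ((γ 1 1 : ℤ) : ℝ) = r := by rw [e 1 1]; simp
    have hb : γ 0 1 = 0 := by exact_mod_cast e01
    have hc0 : γ 1 0 = 0 := by exact_mod_cast e10
    have had : γ 0 0 = γ 1 1 := by exact_mod_cast e00.trans e11.symm
    have hdet2 := hdetZ
    rw [hb, hc0, mul_zero, sub_zero, ← had] at hdet2
    rcases Int.mul_eq_one_iff_eq_one_or_neg_one.mp hdet2 with ⟨ha, -⟩ | ⟨ha, -⟩
    · left
      ext i j
      fin_cases i <;> fin_cases j <;> simp [ha, hb, hc0, ← had]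
    · right
      ext i j
      fin_cases i <;> fin_cases j <;> simp [ha, hb, hc0, ← had]
  · -- non-scalar: elliptic, `tr² < 4`
    exfalso
    have hell := UpperHalfPlane.isElliptic_of_exists_smul_eq_self hdet hc ⟨z, hgz⟩
    have hdisc : g.val.discr < 0 := hell
    rw [Matrix.discr_fin_two, Matrix.trace_fin_two, hdet1, hval 0 0, hval 1 1] at hdisc
    -- `(a + d)² < 4` over `ℝ`, hence `|a + d| ≤ 1` over `ℤ`
    have hsq : ((γ 0 0 + γ 1 1 : ℤ) : ℝ) ^ 2 < 4 := by push_cast; linarith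
    have hsqZ : (γ 0 0 + γ 1 1) ^ 2 < 4 := by exact_mod_cast hsq
    obtain ⟨k, hk⟩ := trace_mod_four hγ
    have had : γ 0 0 + γ 1 1 = 4 * k + 2 := by linear_combination hk
    rw [had] at hsqZ
    rcases le_or_gt 0 k with hk0 | hk0
    · nlinarith [sq_nonneg k]
    · have hprod : 0 ≤ (k + 1) * k :=
        mul_nonneg_of_nonpos_of_nonpos (by linarith) (by linarith)
      nlinarith [hprod]

/-- `γ • z = z ↔ γ = ±1` for `γ ∈ Γ(2)`, `z ∈ ℍ`. [folklore] -/
theorem smul_eq_self_iff {γ : SL(2, ℤ)} (hγ : γ ∈ Gamma 2) {z : ℍ} :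
    γ • z = z ↔ γ = 1 ∨ γ = -1 := by
  refine ⟨eq_one_or_eq_neg_one_of_smul_eq hγ, ?_⟩
  rintro (rfl | rfl)
  · exact one_smul _ z
  · rw [ModularGroup.SL_neg_smul, one_smul]

end GammaTwo

end Literature.NumberTheory.Automorphic
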